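import Mathlib
import HarnessLib

/-!
# [IUTchIII] Cor. 3.12 under the identified-copies reading — ramified-mover kit: the completion
# extension of a bounded additive involution of `K` and what it does to `𝒪_v`-balls

Definition-bearing kit file of the abc-iut cell (Cor. 3.12 STRATEGY TEAM R «refutation
(identified-copies reading)», lead R1 = abc-iut-c312-14; the «ramified non-rational-multiple mover»
successor thread flagged OPEN in `Cor312IdentifiedIndFixes.lean` p418763); TAKES NO SIDE on
[IUTchIII] Cor. 3.12. Everything here is classical valuation theory ([folklore]); nothing cites the
disputed texts.

`Cor312IdentifiedIndFixes.lean` reduced the satisfiability of the identified-copies reading's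
`indFixes` clause at the assembled real setting to one question: does some element of the
Dupuy–Hilado (Ind2) group `Real.ismDH` (bicontinuous `ℚ`-linear automorphisms of `K_v` fixing the
log-shell) MOVE a non-rational multiple of the shell at a ramified place? Its docstring records
that a kernel witness «needs a concrete ramified completion with explicit `ℤ_p`-module structure,
which the tree does not yet carry». THIS FILE removes that obstruction: no `ℤ_p`-module structure
and no `ℚ_p`-algebra structure on `v.adicCompletion K` is needed — a mover is obtained by
COMPLETION EXTENSION from the global field itself. For a Dedekind domain `R` with fraction field
`K` and a finite place `v`:

* §1 EXTENSION: an additive `s : K →+ K` whose valuation grows by at most the fixed factor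
  `v(c)⁻¹` (multiplicative form: `v(c)·v(s x) ≤ v(x)`, no inverses) is continuous for the `v`-adic
  topology (`continuous_withVal`), hence extends to `extHom s : K_v →+ K_v` (Mathlib's
  `AddMonoidHom.completion`) with `extHom_coe : extHom s ↑x = ↑(s x)`; if `s` is an involution so
  is the extension (`extHom_invol`, by density), giving a self-inverse homeomorphism `extHomeo`.
* §2 BALLS: `𝒪_v = closure (image of R)` (`adicCompletionIntegers_eq_closure_range`: `K` is dense
  in `K_v` and `𝒪_v` is clopen, so `v`-integers of `K` are dense in `𝒪_v`, and those are
  approximated by `R` via Mathlib's `exists_valuation_sub_lt_of_integer`). Hence if `s` maps the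
  image of `R` into itself, the involutive extension maps `𝒪_v` onto itself
  (`extHom_image_integers`).
* §3 THE MOVER CORE: if moreover `s c = 1` with `v(c) < 1`, then `extHom s '' (c·𝒪_v) ∋ 1 ∉ c·𝒪_v`:
  the extension fixes `𝒪_v` and MOVES the ball `c·𝒪_v` (`extHom_image_smul_integers_ne`).

Consumer: `Cor312IdentifiedRamifiedMover.lean` instantiates `s` at `K = ℚ(ζ₃)` (the coordinate
swap `A + Bλ ↦ B + Aλ` in the basis `{1, λ}`, `λ = ζ₃ − 1` the ramified prime above `3`) and
derives the `Real.ismDH` mover of the p418763 docstring signature. Every statement is CONDITIONAL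
on its named hypotheses; nothing here bears on the dispute. [folklore] throughout; standard axioms.
-/

noncomputable section

namespace Summit.ABC.IUTFork.RamifiedMover

open IsDedekindDomain IsDedekindDomain.HeightOneSpectrum UniformSpace MonoidWithZeroHom
open scoped Pointwise WithZero

variable {R : Type*} [CommRing R] [IsDedekindDomain R] {K : Type*} [Field K]
  [Algebra R K] [IsFractionRing R K] (v : HeightOneSpectrum R)

/-! ## 0. The coercion `K → K_v` as a bundled additive map -/

/-- The canonical map `K → K_v` as an additive monoid homomorphism. [folklore] -/
def coeHom : K →+ v.adicCompletion K where
  toFun x := (↑x : v.adicCompletion K)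
  map_zero' := adicCompletion.coe_zero K v
  map_add' := adicCompletion.coe_add K v

/-- `coeHom` is the coercion, definitionally. [folklore] -/
theorem coeHom_apply (x : K) : coeHom v x = (↑x : v.adicCompletion K) := rfl

/-- The coercion has dense range (Mathlib's `denseRange_algebraMap`). [folklore] -/
theorem denseRange_coeHom : DenseRange (coeHom v (K := K)) := by
  have h := denseRange_algebraMap K v
  have hfun : ⇑(algebraMap K (v.adicCompletion K)) = ⇑(coeHom v (K := K)) := by
    rw [algebraMap_adicCompletion]
    funext x
    simp [coeHom_apply, Algebra.algebraMap_self]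
  rwa [hfun] at h

/-! ## 1. Completion extension of a bounded additive map -/

/-- An additive map of `K`, read on the valued synonym `WithVal (v.valuation K)` (the carrier of
the `v`-adic uniformity). [folklore] -/
def withVal (s : K →+ K) : WithVal (v.valuation K) →+ WithVal (v.valuation K) where
  toFun x := WithVal.toVal _ (s x.ofVal)
  map_zero' := by
    show WithVal.toVal _ (s (0 : WithVal (v.valuation K)).ofVal) = 0
    rw [show ((0 : WithVal (v.valuation K)).ofVal) = (0 : K) from rfl, map_zero]
    rfl
  map_add' a b := by
    show WithVal.toVal _ (s ((a + b).ofVal)) = WithVal.toVal _ (s a.ofVal) + WithVal.toVal _ (s b.ofVal)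
    rw [show (a + b).ofVal = a.ofVal + b.ofVal from rfl, map_add]
    rfl

/-- `withVal` acts as `s` through `toVal`/`ofVal`, definitionally. [folklore] -/
theorem withVal_apply (s : K →+ K) (x : WithVal (v.valuation K)) :
    withVal v s x = WithVal.toVal _ (s x.ofVal) :=
  rfl

/-- **Bounded additive maps are `v`-adically continuous**: if `v(c) · v(s x) ≤ v(x)` for a fixed
`c ≠ 0`, then `s` is continuous for the `v`-adic topology. [folklore] -/
theorem continuous_withVal (s : K →+ K) (c : K) (hc : c ≠ 0)
    (hs : ∀ x : K, v.valuation K c * v.valuation K (s x) ≤ v.valuation K x) :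
    Continuous (withVal v s) := by
  apply continuous_of_continuousAt_zero (withVal v s)
  rw [ContinuousAt, map_zero]
  rw [(Valued.hasBasis_nhds_zero _ _).tendsto_iff (Valued.hasBasis_nhds_zero _ _)]
  intro γ _
  have hvc : v.valuation K c ≠ 0 := by simpa using hc
  refine ⟨Units.mk0 ((Valued.v).restrict (WithVal.toVal (v.valuation K) c) * γ.1)
    (by
      simp only [ne_eq, mul_eq_zero, not_or]
      refine ⟨?_, γ.ne_zero⟩
      rw [Valuation.restrict_eq_zero_iff]
      simpa using hc),
    trivial, ?_⟩
  intro x hx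
  simp only [Set.mem_setOf_eq] at hx ⊢
  rw [Units.val_mk0, Valuation.restrict_lt_iff_lt_embedding, map_mul,
    Valuation.embedding_restrict] at hx
  rw [Valuation.restrict_lt_iff_lt_embedding]
  -- hx : Valued.v x < Valued.v (toVal c) * embedding γ.1, all in ℤᵐ⁰ of the `WithVal` valuation
  have hxv : v.valuation K x.ofVal < v.valuation K c * ValueGroup₀.embedding γ.1 := hx
  have hsx : v.valuation K c * v.valuation K (s x.ofVal) ≤ v.valuation K x.ofVal := hs _
  have hgoal : v.valuation K (s x.ofVal) < ValueGroup₀.embedding γ.1 := by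
    by_contra hge
    have hge' : ValueGroup₀.embedding γ.1 ≤ v.valuation K (s x.ofVal) := not_lt.mp hge
    have h1 : v.valuation K c * ValueGroup₀.embedding γ.1 ≤
        v.valuation K c * v.valuation K (s x.ofVal) := mul_le_mul' le_rfl hge'
    exact absurd (lt_of_le_of_lt (h1.trans hsx) hxv) (lt_irrefl _)
  exact hgoal

/-- Hence uniformly continuous (additive + continuous on a uniform additive group). [folklore] -/
theorem uniformContinuous_withVal (s : K →+ K) (c : K) (hc : c ≠ 0)
    (hs : ∀ x : K, v.valuation K c * v.valuation K (s x) ≤ v.valuation K x) :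
    UniformContinuous (withVal v s) :=
  uniformContinuous_addMonoidHom_of_continuous (continuous_withVal v s c hc hs)

variable {s : K →+ K} {c : K}

/-- **The completion extension** `K_v →+ K_v` of a bounded additive map `s : K →+ K`
(Mathlib's `AddMonoidHom.completion`, read through `adicCompletion`'s wrapper). [folklore] -/
def extHom (hc : c ≠ 0)
    (hs : ∀ x : K, v.valuation K c * v.valuation K (s x) ≤ v.valuation K x) :
    v.adicCompletion K →+ v.adicCompletion K where
  toFun y := adicCompletion.ofCompletion
    (((withVal v s).completion (continuous_withVal v s c hc hs)) y.toCompletion)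
  map_zero' := by
    apply adicCompletion.ext
    simp
  map_add' a b := by
    apply adicCompletion.ext
    simp

variable (hc : c ≠ 0)
  (hs : ∀ x : K, v.valuation K c * v.valuation K (s x) ≤ v.valuation K x)

/-- `extHom` unfolded, definitionally. [folklore] -/
theorem extHom_apply (y : v.adicCompletion K) :
    extHom v hc hs y = adicCompletion.ofCompletion
      (((withVal v s).completion (continuous_withVal v s c hc hs)) y.toCompletion) :=
  rfl

/-- The extension is continuous. [folklore] -/
theorem continuous_extHom : Continuous (extHom v hc hs) := by
  have h1 : Continuous (((withVal v s).completion (continuous_withVal v s c hc hs)) ∘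
      (adicCompletion.toCompletion (K := K) (v := v))) :=
    ((withVal v s).continuous_completion (continuous_withVal v s c hc hs)).comp
      (adicCompletion.continuous_toCompletion K v)
  exact (adicCompletion.continuous_ofCompletion K v).comp h1

/-- The extension extends: `extHom s ↑x = ↑(s x)` for `x ∈ K`. [folklore] -/
theorem extHom_coe (x : K) : extHom v hc hs (coeHom v x) = coeHom v (s x) := by
  apply adicCompletion.ext
  show ((withVal v s).completion (continuous_withVal v s c hc hs))
      ((coeHom v x).toCompletion) = (coeHom v (s x)).toCompletion
  have h1 : (coeHom v x).toCompletion =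
      ((WithVal.toVal (v.valuation K) x : WithVal (v.valuation K)) :
        (v.valuation K).Completion) := rfl
  have h2 : (coeHom v (s x)).toCompletion =
      ((WithVal.toVal (v.valuation K) (s x) : WithVal (v.valuation K)) :
        (v.valuation K).Completion) := rfl
  rw [h1, h2, AddMonoidHom.completion_coe _ (continuous_withVal v s c hc hs)]
  rfl

/-- **Involutions extend to involutions** (by density: the coincidence set of two continuous maps
is closed). [folklore] -/
theorem extHom_invol (hinv : ∀ x, s (s x) = x) :
    Function.Involutive (extHom v hc hs) := by
  intro y
  have hcl : IsClosed {z : v.adicCompletion K |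
      extHom v hc hs (extHom v hc hs z) = z} :=
    isClosed_eq ((continuous_extHom v hc hs).comp (continuous_extHom v hc hs)) continuous_id
  refine hcl.closure_subset ?_
  have hsub : Set.range (coeHom v (K := K)) ⊆
      {z | extHom v hc hs (extHom v hc hs z) = z} := by
    rintro _ ⟨x, rfl⟩
    simp only [Set.mem_setOf_eq, extHom_coe, hinv]
  have hcls := (denseRange_coeHom v (K := K)).closure_eq
  have : y ∈ closure (Set.range (coeHom v (K := K))) := by
    rw [hcls]; trivial
  exact closure_mono hsub this

/-- The extension of an involution as a self-inverse homeomorphism of `K_v`. [folklore] -/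
def extHomeo (hinv : ∀ x, s (s x) = x) : v.adicCompletion K ≃ₜ v.adicCompletion K where
  toFun := extHom v hc hs
  invFun := extHom v hc hs
  left_inv := extHom_invol v hc hs hinv
  right_inv := extHom_invol v hc hs hinv
  continuous_toFun := continuous_extHom v hc hs
  continuous_invFun := continuous_extHom v hc hs

/-- `extHomeo` acts by `extHom`, definitionally. [folklore] -/
theorem extHomeo_apply (hinv : ∀ x, s (s x) = x) (y : v.adicCompletion K) :
    extHomeo v hc hs hinv y = extHom v hc hs y :=
  rfl

/-! ## 2. `𝒪_v` is the closure of the image of `R` -/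

/-- The local integers as a subset: `{y | Valued.v y ≤ 1}`. [folklore] -/
theorem coe_adicCompletionIntegers :
    (v.adicCompletionIntegers K : Set (v.adicCompletion K)) =
      {y : v.adicCompletion K | Valued.v y ≤ 1} := by
  ext z
  simp only [SetLike.mem_coe, mem_adicCompletionIntegers, Set.mem_setOf_eq]

/-- `𝒪_v ⊆ K_v` is clopen. [folklore] -/
theorem isClopen_adicCompletionIntegers :
    IsClopen (v.adicCompletionIntegers K : Set (v.adicCompletion K)) := by
  rw [coe_adicCompletionIntegers]
  have h1 : IsClopen {z : v.adicCompletion K | (Valued.v).restrict z ≤ 1} :=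
    Valued.isClopen_closedBall (v.adicCompletion K) one_ne_zero
  have h2 : {z : v.adicCompletion K | (Valued.v).restrict z ≤ 1} =
      {z : v.adicCompletion K | Valued.v z ≤ 1} := by
    ext z
    simp only [Set.mem_setOf_eq, Valuation.restrict_le_one_iff]
  rwa [h2] at h1

/-- **`𝒪_v` is the closure of the image of `R`**: `K` is dense and `𝒪_v` is clopen, so the
`v`-integers of `K` are dense in `𝒪_v`; each of them is within any valuation distance of an
element of `R` (Mathlib `exists_valuation_sub_lt_of_integer`). [folklore] -/
theorem adicCompletionIntegers_eq_closure_range :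
    (v.adicCompletionIntegers K : Set (v.adicCompletion K)) =
      closure (Set.range fun a : R => coeHom v (algebraMap R K a)) := by
  apply subset_antisymm
  · -- dense-open: 𝒪_v ⊆ closure (𝒪_v ∩ K) ⊆ closure (R-image)
    have hdense : (v.adicCompletionIntegers K : Set (v.adicCompletion K)) ⊆
        closure ((v.adicCompletionIntegers K : Set (v.adicCompletion K)) ∩
          Set.range (coeHom v (K := K))) :=
      (denseRange_coeHom v).open_subset_closure_inter (isClopen_adicCompletionIntegers v).isOpen
    have hsub : ((v.adicCompletionIntegers K : Set (v.adicCompletion K)) ∩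
        Set.range (coeHom v (K := K))) ⊆
        closure (Set.range fun a : R => coeHom v (algebraMap R K a)) := by
      rintro z ⟨hz, x, rfl⟩
      have hx1 : v.valuation K x ≤ 1 := by
        rw [coe_adicCompletionIntegers] at hz
        rwa [Set.mem_setOf_eq, coeHom_apply, valuedAdicCompletion_eq_valuation'] at hz
      rw [mem_closure_iff_nhds]
      intro U hU
      obtain ⟨γ, hγU⟩ := Valued.mem_nhds.mp hU
      have hγ0 : ValueGroup₀.embedding (γ.1 :
          ValueGroup₀ (MonoidWithZeroHom.ofClass (Valued.v (R := v.adicCompletion K)))) ≠ 0 := by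
        have h1 : ValueGroup₀.embedding ((γ * γ⁻¹ : _ˣ).1 :
            ValueGroup₀ (MonoidWithZeroHom.ofClass (Valued.v (R := v.adicCompletion K)))) =
            1 := by
          rw [mul_inv_cancel]
          exact map_one _
        rw [Units.val_mul, map_mul] at h1
        exact left_ne_zero_of_mul_eq_one h1
      obtain ⟨a, ha⟩ := v.exists_valuation_sub_lt_of_integer hx1 (Units.mk0 _ hγ0)
      refine ⟨coeHom v (algebraMap R K a), hγU ?_, ⟨a, rfl⟩⟩
      simp only [Set.mem_setOf_eq]
      rw [Valuation.restrict_lt_iff_lt_embedding, ← map_sub,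
        coeHom_apply, valuedAdicCompletion_eq_valuation']
      simpa using ha
    calc (v.adicCompletionIntegers K : Set (v.adicCompletion K))
        ⊆ closure ((v.adicCompletionIntegers K : Set (v.adicCompletion K)) ∩
            Set.range (coeHom v (K := K))) := hdense
      _ ⊆ closure (closure (Set.range fun a : R => coeHom v (algebraMap R K a))) :=
            closure_mono hsub
      _ = closure (Set.range fun a : R => coeHom v (algebraMap R K a)) := closure_closure
  · -- the closed set 𝒪_v contains the image of R
    refine closure_minimal ?_ (isClopen_adicCompletionIntegers v).isClosed
    rintro _ ⟨a, rfl⟩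
    show coeHom v (algebraMap R K a) ∈ (v.adicCompletionIntegers K : Set (v.adicCompletion K))
    rw [coe_adicCompletionIntegers, Set.mem_setOf_eq, coeHom_apply,
      valuedAdicCompletion_eq_valuation']
    exact v.valuation_le_one a

/-- **The extension fixes `𝒪_v`** as soon as `s` maps the image of `R` into itself (with the
involution, onto itself). [folklore] -/
theorem extHom_image_integers (hinv : ∀ x, s (s x) = x)
    (hR : ∀ a : R, ∃ b : R, s (algebraMap R K a) = algebraMap R K b) :
    extHom v hc hs '' (v.adicCompletionIntegers K : Set (v.adicCompletion K)) =
      (v.adicCompletionIntegers K : Set (v.adicCompletion K)) := by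
  rw [adicCompletionIntegers_eq_closure_range]
  have h1 : extHom v hc hs '' closure (Set.range fun a : R => coeHom v (algebraMap R K a)) =
      closure (extHom v hc hs '' (Set.range fun a : R => coeHom v (algebraMap R K a))) :=
    (extHomeo v hc hs hinv).image_closure _
  rw [h1]
  congr 1
  apply subset_antisymm
  · rintro _ ⟨_, ⟨a, rfl⟩, rfl⟩
    obtain ⟨b, hb⟩ := hR a
    refine ⟨b, ?_⟩
    rw [extHom_coe, hb]
  · rintro _ ⟨a, rfl⟩
    obtain ⟨b, hb⟩ := hR a
    refine ⟨coeHom v (algebraMap R K b), ⟨b, rfl⟩, ?_⟩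
    rw [extHom_coe, ← hb]
    show coeHom v (s (s (algebraMap R K a))) = coeHom v (algebraMap R K a)
    rw [hinv]

/-! ## 3. The mover core: the ball `c·𝒪_v` is moved -/

/-- `1 ∉ c·𝒪_v` when `v(c) < 1`. [folklore] -/
theorem one_not_mem_smul_integers (hπ : v.valuation K c < 1) :
    (1 : v.adicCompletion K) ∉
      coeHom v c • (v.adicCompletionIntegers K : Set (v.adicCompletion K)) := by
  rintro ⟨w, hw, hw1⟩
  rw [SetLike.mem_coe, mem_adicCompletionIntegers] at hw
  simp only [smul_eq_mul] at hw1
  have h1 : Valued.v (coeHom v c * w) = (1 : ℤᵐ⁰) := by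
    rw [hw1]
    exact Valued.v.map_one
  rw [Valued.v.map_mul, coeHom_apply, valuedAdicCompletion_eq_valuation'] at h1
  have hlt : v.valuation K c * Valued.v w < 1 :=
    lt_of_le_of_lt (mul_le_of_le_one_right' hw) hπ
  rw [h1] at hlt
  exact lt_irrefl _ hlt

/-- **The mover core**: if `s` sends `c` to `1` with `v(c) < 1`, then the extension MOVES the
ball `c·𝒪_v`: its image contains `1 = extHom s (↑c)`, which `c·𝒪_v` omits (no involution or
lattice hypothesis is needed for the move — those enter only through `extHom_image_integers`,
which pins the FIXED set). [folklore] -/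
theorem extHom_image_smul_integers_ne
    (hπ : v.valuation K c < 1) (hsc : s c = 1) :
    extHom v hc hs ''
        (coeHom v c • (v.adicCompletionIntegers K : Set (v.adicCompletion K))) ≠
      coeHom v c • (v.adicCompletionIntegers K : Set (v.adicCompletion K)) := by
  intro hEq
  apply one_not_mem_smul_integers v hπ
  rw [← hEq]
  refine ⟨coeHom v c, ⟨1, one_mem _, ?_⟩, ?_⟩
  · show coeHom v c • (1 : v.adicCompletion K) = coeHom v c
    rw [smul_eq_mul, mul_one]
  · rw [extHom_coe, hsc, coeHom_apply, adicCompletion.coe_one]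

end Summit.ABC.IUTFork.RamifiedMover

end
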